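import Literature.MathematicalPhysics.QuantumLattice.TorusSectorGibbsEntropyRow
import Literature.MathematicalPhysics.QuantumLattice.InfVolFermionStateCompactness
import HarnessLib

/-!
# The «entropy row» in the thermodynamic limit: for every torus limit of the canonical Gibbs states,
# `e_Φ(ω) − Re ω_B(G)/(β|B|) ≤ e(t,t',U,n) + log Tr e^{−G}/(β|B|)`

Topic `MathematicalPhysics/QuantumLattice`; sequel of `TorusSectorGibbsEntropyRow.lean` (finite volume:
`β(E_β − E₀) ≤ N_L·(⟨Γ G⟩ + log Tr e^{−G}) + (L² − N_L|B|)·log 4` for the canonical sector Gibbs state of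
`hubbardTorusTT' L t t' U`, a rectangle `B = ∏_i[0,m_i)` and a Hermitian witness `G ∈ 𝔄_B`). Dividing by
`βL²` and letting `L → ∞` along the sides of a torus limit `ω` (`IsTorusLimitOfMixture` of the sector Gibbs
data; `N_L/L² → 1/|B|`, the seam is `o(L²)`, the torus averages are bounded) gives, by the row passage
`IsTorusLimitOfMixture.mul_meanEnergy_add_mul_re_expect_le_of_eventually_sectorGibbs`
(`TorusLimitOfMixturesLimsup.lean`), the ENTROPY ROW of the thermal certificates for the tree's thermal
object:

* `IsTorusLimitOfMixture.meanEnergy_sub_re_expect_div_le_of_sectorGibbs_box` —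
  `e_Φ(ω) − Re ω_B(G)/(β|B|) ≤ e(t,t',U,n) + log Re Tr e^{−G}/(β|B|)` (`β > 0`, `U ≥ 0`, `0 ≤ n < 2`,
  `|B| = ∏ m_i`, `m_i > 0`), i.e. `0 ≤ Re ω(G_e)` for the extra row
  `G_e = (e₀⁺ + log Tr e^{−G}/(β|B|))·1 − Γ E_Φ + Γ G/(β|B|)` of the thermal reader once `e(n) ≤ e₀⁺`
  (an input row, e.g. a certified variational upper bound on the ground-state energy density).

Auxiliary (PROVED): a norm bound on translation averages of an arbitrary local observable
(`norm_torusAvgExpect_le_sum_norm`), the tiling asymptotics `N_L·|B| ≤ L²`,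
`#rectTilingVecs m L / L² → 1/∏ m_i` (`tendsto_card_rectTilingVecs_div_sq`), and the row algebra. No
definition, no named fact.

References: Araki–Moriya 2003 Thm. 3.8/§10 [ArakiMoriya2003]; Israel 1979 Lemma II.3.1, §I.3 (26)
[Israel1979]; Bratteli–Robinson I §4.3.1 [BratteliRobinsonI1987]; Friedli–Velenik 2017 §3.2, §6.9
[FriedliVelenik2017].
-/

noncomputable section

namespace Literature.MathematicalPhysics.QuantumLattice

open Matrix Finset HubbardWave0 Literature.Probability.LatticeModels ThermodynamicLimit
open Literature.InformationTheory.Entropy (vonNeumannEntropy)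
open _root_.Filter
open scoped _root_.Topology ComplexOrder BigOperators

/-! ### §1 Bounded translation averages -/

section Bounded

variable {d : ℕ}

/-- **Translation averages of a local observable are bounded**: for a unit torus vector `ψ` and `A ∈ 𝔄_Λ`,
`‖torusAvgExpect L Λ A ψ‖ ≤ Σ_{s,t} ‖A_{st}‖` (expand `A` in matrix units, each of average `≤ 1` in norm).
[cite: BratteliRobinsonI1987, §4.3.1 (PDF pp. 373–375)] -/
theorem norm_torusAvgExpect_le_sum_norm (L : ℕ) (Λ : Finset (Site d)) (A : FermionOp Λ)
    {ψ : Fock (Orb (FermionTorus d L))} (hψ : star ψ ⬝ᵥ ψ = 1) :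
    ‖torusAvgExpect L Λ A ψ‖ ≤ ∑ s, ∑ t, ‖A s t‖ := by
  rw [torusAvgExpect_eq_sum_single L Λ A ψ]
  refine (norm_sum_le _ _).trans (Finset.sum_le_sum fun s _ => (norm_sum_le _ _).trans
    (Finset.sum_le_sum fun t _ => ?_))
  rw [norm_mul]
  exact mul_le_of_le_one_right (norm_nonneg _) (norm_torusAvgExpect_single_le L Λ s t hψ)

/-- **Mixture averages are bounded**: for probability weights and unit vectors,
`|Σ_i p_i Re torusAvgExpect L Λ A ψ_i| ≤ Σ_{s,t} ‖A_{st}‖`. [cite: BratteliRobinsonI1987, §4.3.1 (PDF pp. 373–375)] -/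
theorem abs_sum_mul_re_torusAvgExpect_le {k : ℕ} (L : ℕ) (Λ : Finset (Site d)) (A : FermionOp Λ)
    (p : Fin k → ℝ) (ψ : Fin k → Fock (Orb (FermionTorus d L)))
    (hp0 : ∀ i, 0 ≤ p i) (hp1 : ∑ i, p i = 1) (hψ : ∀ i, star (ψ i) ⬝ᵥ ψ i = 1) :
    |∑ i, p i * (torusAvgExpect L Λ A (ψ i)).re| ≤ ∑ s, ∑ t, ‖A s t‖ := by
  set M := ∑ s, ∑ t, ‖A s t‖ with hM
  calc |∑ i, p i * (torusAvgExpect L Λ A (ψ i)).re|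
      ≤ ∑ i, |p i * (torusAvgExpect L Λ A (ψ i)).re| := Finset.abs_sum_le_sum_abs _ _
    _ ≤ ∑ i, p i * M := Finset.sum_le_sum fun i _ => by
        rw [abs_mul, abs_of_nonneg (hp0 i)]
        exact mul_le_mul_of_nonneg_left
          ((Complex.abs_re_le_norm _).trans (norm_torusAvgExpect_le_sum_norm L Λ A (hψ i))) (hp0 i)
    _ = M := by rw [← Finset.sum_mul, hp1, one_mul]

end Bounded

/-! ### §2 Tiling asymptotics: `N_L |B| ≤ L²` and `N_L / L² → 1/|B|` -/

section Tiling

/-- `N_L · |B| ≤ L²` for the tiling of `[0,L)²` by translates of `∏_i [0,m_i)` (`⌊L/m⌋·m ≤ L`).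
[cite: FriedliVelenik2017, §3.2] -/
theorem card_rectTilingVecs_mul_prod_le {m : Fin 2 → ℕ} (hm : ∀ i, 0 < m i) (L : ℕ) :
    (#(rectTilingVecs m L) : ℝ) * ∏ i, (m i : ℝ) ≤ (L : ℝ) ^ 2 := by
  have h : #(rectTilingVecs m L) * ∏ i, m i ≤ L ^ 2 := by
    rw [card_rectTilingVecs hm, ← Finset.prod_mul_distrib]
    calc ∏ i, L / m i * m i ≤ ∏ _i : Fin 2, L := Finset.prod_le_prod' fun i _ => Nat.div_mul_le_self L (m i)
      _ = L ^ 2 := by simp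
  exact_mod_cast h

/-- `(L + c)/L → 1`. [folklore] -/
private theorem tendsto_natCast_add_div (c : ℝ) :
    Tendsto (fun L : ℕ => ((L : ℝ) + c) / (L : ℝ)) atTop (𝓝 1) := by
  have h : Tendsto (fun L : ℕ => 1 + c / (L : ℝ)) atTop (𝓝 (1 + 0)) :=
    tendsto_const_nhds.add (tendsto_const_div_atTop_nhds_zero_nat c)
  rw [add_zero] at h
  refine h.congr' ?_
  filter_upwards [eventually_gt_atTop 0] with L hL
  have hL' : (L : ℝ) ≠ 0 := Nat.cast_ne_zero.2 (by omega)
  field_simp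

/-- The coverage ratio tends to one: `∏_i (L + 1 − m_i) / L² → 1` (`d = 2`). [cite: FriedliVelenik2017, §6.9] -/
private theorem tendsto_prod_sub_div_sq (m : Fin 2 → ℕ) :
    Tendsto (fun L : ℕ => (∏ i, ((L + 1 - m i : ℕ) : ℝ)) / (L : ℝ) ^ 2) atTop (𝓝 1) := by
  have h := (tendsto_natCast_add_div (1 - (m 0 : ℝ))).mul (tendsto_natCast_add_div (1 - (m 1 : ℝ)))
  rw [mul_one] at h
  refine h.congr' ?_
  filter_upwards [eventually_ge_atTop (m 0 + m 1)] with L hL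
  rw [Fin.prod_univ_two, Nat.cast_sub (by omega), Nat.cast_sub (by omega)]
  push_cast
  ring

/-- **`N_L / L² → 1/|B|`**: `#rectTilingVecs m L / L² → (∏ m_i)⁻¹` (squeezed between the coverage bound
`∏(L+1−m_i) ≤ N_L|B|` and `N_L|B| ≤ L²`). [cite: FriedliVelenik2017, §3.2] -/
theorem tendsto_card_rectTilingVecs_div_sq {m : Fin 2 → ℕ} (hm : ∀ i, 0 < m i) :
    Tendsto (fun L : ℕ => (#(rectTilingVecs m L) : ℝ) / (L : ℝ) ^ 2) atTop (𝓝 (1 / ∏ i, (m i : ℝ))) := by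
  have hP : 0 < ∏ i, (m i : ℝ) := Finset.prod_pos fun i _ => by exact_mod_cast hm i
  have hlo : Tendsto (fun L : ℕ => (∏ i, ((L + 1 - m i : ℕ) : ℝ)) / (L : ℝ) ^ 2 / ∏ i, (m i : ℝ)) atTop
      (𝓝 (1 / ∏ i, (m i : ℝ))) := (tendsto_prod_sub_div_sq m).div_const _
  refine tendsto_of_tendsto_of_tendsto_of_le_of_le' hlo tendsto_const_nhds ?_ ?_
  · filter_upwards [eventually_gt_atTop 0] with L hL
    have hL2 : (0 : ℝ) < (L : ℝ) ^ 2 := by positivity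
    have hcov : (∏ i, ((L + 1 - m i : ℕ) : ℝ)) ≤ (#(rectTilingVecs m L) : ℝ) * ∏ i, (m i : ℝ) := by
      exact_mod_cast prod_sub_le_card_rectTilingVecs_mul hm L
    rw [div_div, div_le_div_iff₀ (mul_pos hL2 hP) hL2]
    nlinarith
  · filter_upwards [eventually_gt_atTop 0] with L hL
    have hL2 : (0 : ℝ) < (L : ℝ) ^ 2 := by positivity
    rw [div_le_div_iff₀ hL2 hP, one_mul]
    exact card_rectTilingVecs_mul_prod_le hm L

end Tiling

/-! ### §3 The row algebra -/

/-- From `β(E − E₀) ≤ N(A + lz) + (L² − N P)·l₄`, `N P ≤ L²`, `|A| ≤ M` and the smallness of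
`δ = 1/P − N/L²`: `E/L² − A/(βP) ≤ E₀/L² + lz/(βP) + ε`. [folklore] -/
private theorem row_algebra {β P Lsq N E E0 A lz M ε δ l4 : ℝ} (hβ : 0 < β) (hL : 0 < Lsq) (hP : 0 < P)
    (hrow : β * (E - E0) ≤ N * (A + lz) + (Lsq - N * P) * l4) (hNP : N * P ≤ Lsq) (hA : |A| ≤ M)
    (hδ : δ = 1 / P - N / Lsq) (hε : δ * (P * l4 + M + |lz|) / β ≤ ε) :
    E / Lsq - 1 / (β * P) * A ≤ E0 / Lsq + lz / (β * P) + ε := by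
  have hδ0 : 0 ≤ δ := by
    rw [hδ, sub_nonneg, div_le_div_iff₀ hL hP, one_mul]
    exact hNP
  have e1 : N - Lsq / P = -(Lsq * δ) := by rw [hδ]; field_simp; ring
  have e2 : Lsq - N * P = P * (Lsq * δ) := by rw [hδ]; field_simp
  have hLδ : 0 ≤ Lsq * δ := mul_nonneg hL.le hδ0
  have hA' : -A ≤ M := (neg_le_abs A).trans hA
  have hlz : -lz ≤ |lz| := neg_le_abs lz
  have hε' : δ * (P * l4 + M + |lz|) ≤ β * ε := by
    rwa [div_le_iff₀ hβ, mul_comm ε β] at hε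
  have key : (N - Lsq / P) * A + (N - Lsq / P) * lz + (Lsq - N * P) * l4 ≤ β * Lsq * ε := by
    rw [e1, e2]
    have h1 : -(Lsq * δ) * A ≤ Lsq * δ * M := by
      rw [neg_mul, ← mul_neg]; exact mul_le_mul_of_nonneg_left hA' hLδ
    have h2 : -(Lsq * δ) * lz ≤ Lsq * δ * |lz| := by
      rw [neg_mul, ← mul_neg]; exact mul_le_mul_of_nonneg_left hlz hLδ
    have h3 : Lsq * (δ * (P * l4 + M + |lz|)) ≤ Lsq * (β * ε) := mul_le_mul_of_nonneg_left hε' hL.le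
    nlinarith
  have hβL : 0 < β * Lsq := mul_pos hβ hL
  rw [show E / Lsq - 1 / (β * P) * A = (β * E - Lsq / P * A) / (β * Lsq) by field_simp,
    show E0 / Lsq + lz / (β * P) + ε = (β * E0 + Lsq / P * lz + β * Lsq * ε) / (β * Lsq) by field_simp,
    div_le_div_iff_of_pos_right hβL]
  nlinarith

/-! ### §4 The entropy row for thermal torus limits -/

/-- **The ENTROPY ROW for thermal torus limits.** Let `ω` be a torus limit of the canonical
`(rectN n L, S^z = 0)` Gibbs states of `hubbardTorusTT' L t t' U` at inverse temperature `β > 0`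
(`IsTorusLimitOfMixture`, along any `Ls → ∞`; `U ≥ 0`, `0 ≤ n < 2`), `B = ∏_i [0,m_i)` a rectangle
(`m_i > 0`, `|B| = ∏ m_i`) and `G ∈ 𝔄_B` a Hermitian «entropy witness». Then
`e_{Φ(t,t',U)}(ω) − Re ω_B(G)/(β|B|) ≤ e(t,t',U,n) + log Re Tr e^{−G}/(β|B|)`
— `e − T·s ≤ e₀` for the entropy density `s ≤ S(ω_B)/|B| ≤ (⟨G⟩ + log Tr e^{−G})/|B|` (box subadditivity +
Klein), proved on the finite tori (`sectorGibbs_energy_sub_groundEnergy_le_box`) and passed to the limit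
(`mul_meanEnergy_add_mul_re_expect_le_of_eventually_sectorGibbs`). With a certified `e(n) ≤ e₀⁺` this is the
extra row `0 ≤ Re ω((e₀⁺ + log Tr e^{−G}/(β|B|))·1 − Γ E_Φ + Γ G/(β|B|))` of the thermal certificate reader.
[cite: Israel1979, Lemma II.3.1] [cite: ArakiMoriya2003, Theorem 3.8 and §10] -/
theorem IsTorusLimitOfMixture.meanEnergy_sub_re_expect_div_le_of_sectorGibbs_box
    (t t' : ℝ) {U : ℝ} (hU : 0 ≤ U) {n : ℝ} (hn0 : 0 ≤ n) (hn2 : n < 2) {β : ℝ} (hβ : 0 < β)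
    {ω : InfVolFermionState 2} {Ls : ℕ → ℕ}
    (h : ω.IsTorusLimitOfMixture (sectorGibbsCount n) (fun L => sectorGibbsWeightTT' β t t' U n L)
      (fun L => sectorGibbsVectorTT' t t' U n L) Ls)
    (hLs : Tendsto Ls atTop atTop) {m : Fin 2 → ℕ} (hm : ∀ i, 0 < m i)
    {G : FermionOp (halfOpenRect m)} (hG : G.IsHermitian) :
    ω.meanEnergy (hubbardTTPrimeFermionInteraction t t' U) 1 -
        1 / (β * ∏ i, (m i : ℝ)) * (ω.expect (halfOpenRect m) G).re ≤
      energyDensityTT' t t' U n + Real.log (partitionFn 1 G).re / (β * ∏ i, (m i : ℝ)) := by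
  set P : ℝ := ∏ i, (m i : ℝ) with hPdef
  have hP : 0 < P := Finset.prod_pos fun i _ => by exact_mod_cast hm i
  set M : ℝ := ∑ s, ∑ t, ‖G s t‖ with hMdef
  set lz : ℝ := Real.log (partitionFn 1 G).re with hlz
  set K : ℝ := P * Real.log 4 + M + |lz| with hK
  -- `δ_L = 1/P − N_L/L² → 0`
  have hδ : Tendsto (fun L : ℕ => (1 / P - (#(rectTilingVecs m L) : ℝ) / (L : ℝ) ^ 2) * K / β) atTop (𝓝 0) := by
    have h1 := (tendsto_const_nhds (x := 1 / P)).sub (tendsto_card_rectTilingVecs_div_sq hm)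
    rw [sub_self] at h1
    have h2 := (h1.mul_const K).div_const β
    rwa [zero_mul, zero_div] at h2
  have key := h.mul_meanEnergy_add_mul_re_expect_le_of_eventually_sectorGibbs t t' hU hn0 hn2 β hLs
    (halfOpenRect m) G (a := 1) (κ := -(1 / (β * P))) (b := 1) (c := lz / (β * P)) ?_
  · simpa [sub_eq_add_neg, hPdef, hlz] using key
  intro ε hε
  filter_upwards [hδ.eventually (gt_mem_nhds hε), eventually_ge_atTop (m 0 + m 1 + 1)] with L hδL hL
  haveI : NeZero L := ⟨by omega⟩
  have hmL : ∀ i, m i ≤ L := fun i => by fin_cases i <;> simp <;> omega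
  have hL0 : (0 : ℝ) < (L : ℝ) := Nat.cast_pos.2 (NeZero.pos L)
  have hLsq : (0 : ℝ) < (L : ℝ) ^ 2 := by positivity
  -- the finite-volume row at side `L`
  have hrow := sectorGibbs_energy_sub_groundEnergy_le_box L t t' U hn0 hn2.le hβ hmL hG
  -- the torus averages: complex form of the row passage vs the real form of the row
  have havg : (∑ i, (sectorGibbsWeightTT' β t t' U n L i : ℂ) *
        torusAvgExpect L (halfOpenRect m) G (sectorGibbsVectorTT' t t' U n L i)).re =
      ∑ i, sectorGibbsWeightTT' β t t' U n L i *
        (torusAvgExpectAt L (halfOpenRect m) G (sectorGibbsVectorTT' t t' U n L i)).re := by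
    rw [Complex.re_sum]
    refine Finset.sum_congr rfl fun i _ => ?_
    rw [Complex.re_ofReal_mul, torusAvgExpect_eq]
  have hA : |∑ i, sectorGibbsWeightTT' β t t' U n L i *
      (torusAvgExpectAt L (halfOpenRect m) G (sectorGibbsVectorTT' t t' U n L i)).re| ≤ M := by
    have h := abs_sum_mul_re_torusAvgExpect_le L (halfOpenRect m) G
      (fun i => sectorGibbsWeightTT' β t t' U n L i) (fun i => sectorGibbsVectorTT' t t' U n L i)
      (fun i => sectorGibbsWeightTT'_nonneg β t t' U n L i) (sum_sectorGibbsWeightTT' β t t' U hn0 hn2.le L)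
      (fun i => star_sectorGibbsVectorTT'_dotProduct_self t t' U n L i)
    simp_rw [torusAvgExpect_eq] at h
    exact h
  have henergy : ∑ i, sectorGibbsWeightTT' β t t' U n L i *
        ((expect (hubbardTorusTT' L t t' U) (sectorGibbsVectorTT' t t' U n L i)).re / (L : ℝ) ^ 2) =
      (∑ i, sectorGibbsWeightTT' β t t' U n L i *
        (expect (hubbardTorusTT' L t t' U) (sectorGibbsVectorTT' t t' U n L i)).re) / (L : ℝ) ^ 2 := by
    rw [Finset.sum_div]
    refine Finset.sum_congr rfl fun i _ => ?_
    ring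
  have halg := row_algebra (ε := ε) hβ hLsq hP hrow (card_rectTilingVecs_mul_prod_le hm L) hA rfl hδL.le
  rw [havg, henergy, one_mul, one_mul]
  linarith

end Literature.MathematicalPhysics.QuantumLattice

end
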